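import Literature.NumberTheory.GaloisRepresentations.AbsGaloisOuterConj
import Literature.NumberTheory.ComplexMultiplication.CMLatticeRingClassTowerRamified
import Mathlib.RingTheory.DedekindDomain.Factorization
import Mathlib.NumberTheory.RamificationInertia.Galois
import HarnessLib

/-!
# Quadratic-field glue for `stub_chebotarevSupplyAtThree` (crux 19109, line `inert`; STUB-PLAN GLUE)

Crux `stmt-BirchSwinnertonDyer-19109` (`EulerHalvesAtThree`), line `inert` (tam3-p1 g18, skeleton r19),
registered stub `stub_chebotarevSupplyAtThree`.  Elementary facts about a quadratic field `K` used to
manufacture the Kummer datum `γ₀` from the generator `β` of `v^A (t)`: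

* `exists_aut_ne_one` — the non-trivial automorphism `τ`; every automorphism is `1` or `τ`;
* `smul_asIdeal_ne_of_ncard_eq_two` — for a rational prime `q` with two primes in `K` and `v ∣ q`:
  `τ v ≠ v`;
* `pow_dvd_of_smul_rel` — `(β) = v^A (t)`, `τv ≠ v`, `β γ₂^{3^j} = (τβ) γ₁^{3^j}` force `3^j ∣ A`
  (count the prime `v`, `FractionalIdeal.count`);
* `eq_one_of_pow_eq_one_of_odd` — with `#𝓞_K^× = 2`, a root of unity of odd order in `K` is `1`.

HONEST FRAMING: helper lemmas toward one registered stub of one line of crux 19109; nothing about BSD is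
proved here.

## References

* J. Neukirch, *Algebraic Number Theory* (1999), Ch. I §3 (Dedekind domains), §9 Prop. (9.1). [NeukirchANT1999]

## Mathlib / tree search

Tree: `CMTypeLattice.units_eq_one_or_neg_one_of_natCard_eq_two`.  Mathlib: `IsGalois.card_aut_eq_finrank`,
`Ideal.exists_smul_eq_of_isGaloisGroup`, `IsGaloisGroup.of_isFractionRing`, `Ideal.pointwise_smul_def`,
`Ideal.IsPrime.smul`, `FractionalIdeal.count_mul/_pow/_self/_maximal_coprime`, `IsIntegral.of_pow`,
`IsUnit.of_pow_eq_one`, `Odd.neg_one_pow`.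
-/

noncomputable section

set_option autoImplicit false
set_option linter.dupNamespace false

open scoped NumberField Pointwise nonZeroDivisors
open Field IsDedekindDomain NumberField
open Literature.NumberTheory.GaloisRepresentations Literature.NumberTheory.EllipticCurves

namespace Summit.BirchSwinnertonDyer.BirchSwinnertonDyer.Theorems.ChebSupply

variable {K : Type} [Field K] [NumberField K]

/-- A quadratic field has a non-trivial automorphism `τ`, and every automorphism is `1` or `τ`. [folklore] -/
theorem exists_aut_ne_one (h2 : Module.finrank ℚ K = 2) :
    ∃ τ : K ≃ₐ[ℚ] K, τ ≠ 1 ∧ ∀ σ : K ≃ₐ[ℚ] K, σ = 1 ∨ σ = τ := by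
  classical
  haveI : Algebra.IsQuadraticExtension ℚ K := ⟨h2⟩
  have hcard : Nat.card (K ≃ₐ[ℚ] K) = 2 := by rw [IsGalois.card_aut_eq_finrank, h2]
  haveI : Fintype (K ≃ₐ[ℚ] K) := Fintype.ofFinite _
  have hcard' : Fintype.card (K ≃ₐ[ℚ] K) = 2 := by rw [← Nat.card_eq_fintype_card, hcard]
  obtain ⟨τ, hτ⟩ : ∃ τ : K ≃ₐ[ℚ] K, τ ≠ 1 := by
    by_contra h
    push Not at h
    have : Fintype.card (K ≃ₐ[ℚ] K) ≤ 1 := Fintype.card_le_one_iff.mpr fun a b => by rw [h a, h b]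
    omega
  refine ⟨τ, hτ, fun σ => ?_⟩
  by_contra hσ
  push Not at hσ
  have h3 : Finset.card ({1, τ, σ} : Finset (K ≃ₐ[ℚ] K)) = 3 := by
    rw [Finset.card_insert_of_notMem (by simp [Ne.symm hτ, Ne.symm hσ.1]),
      Finset.card_pair (Ne.symm hσ.2)]
  have := Finset.card_le_univ ({1, τ, σ} : Finset (K ≃ₐ[ℚ] K))
  rw [h3, hcard'] at this
  omega

/-- **The conjugate of a prime over a split rational prime is a different prime**: if `q` has two
primes in the quadratic field `K` and `v ∣ q`, then `τ v ≠ v` for the non-trivial automorphism `τ`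
(the Galois group is transitive on the primes over `q`, Mathlib `Ideal.exists_smul_eq_of_isGaloisGroup`).
[cite: NeukirchANT1999, Ch. I §9 Prop. (9.1)] -/
theorem smul_asIdeal_ne_of_ncard_eq_two (h2 : Module.finrank ℚ K = 2) {τ : K ≃ₐ[ℚ] K} (hτ : τ ≠ 1)
    (hall : ∀ σ : K ≃ₐ[ℚ] K, σ = 1 ∨ σ = τ) {q : ℕ} (hq : q.Prime)
    (hq2 : ((Ideal.span {(q : ℤ)}).primesOver (𝓞 K)).ncard = 2)
    {v : HeightOneSpectrum (𝓞 K)} (hqv : (q : 𝓞 K) ∈ v.asIdeal) : τ • v.asIdeal ≠ v.asIdeal := by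
  classical
  haveI : Algebra.IsQuadraticExtension ℚ K := ⟨h2⟩
  haveI : IsGaloisGroup (K ≃ₐ[ℚ] K) ℤ (𝓞 K) :=
    IsGaloisGroup.of_isFractionRing (K ≃ₐ[ℚ] K) ℤ (𝓞 K) ℚ K
  intro hfix
  have hmax : (Ideal.span {(q : ℤ)}).IsMaximal :=
    PrincipalIdealRing.isMaximal_of_irreducible (Nat.prime_iff_prime_int.mp hq).irreducible
  have hover : ∀ P : Ideal (𝓞 K), P.IsPrime → (q : 𝓞 K) ∈ P → P.LiesOver (Ideal.span {(q : ℤ)}) :=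
    fun P hP hqP => ⟨(hmax.eq_of_le (Ideal.IsPrime.under ℤ P).ne_top (by
      rw [Ideal.span_singleton_le_iff_mem, Ideal.under_def, Ideal.mem_comap, map_natCast]
      exact hqP))⟩
  haveI := v.isPrime
  haveI := hover v.asIdeal v.isPrime hqv
  -- every prime over `q` is `σ • v` for some `σ`, hence `= v`
  have hsub : (Ideal.span {(q : ℤ)}).primesOver (𝓞 K) = {v.asIdeal} := by
    ext P
    constructor
    · rintro ⟨hP, hPo⟩
      haveI := hP; haveI := hPo
      obtain ⟨σ, hσ⟩ := Ideal.exists_smul_eq_of_isGaloisGroup (Ideal.span {(q : ℤ)}) v.asIdeal P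
        (K ≃ₐ[ℚ] K)
      rw [Set.mem_singleton_iff, ← hσ]
      rcases hall σ with rfl | rfl
      · rw [one_smul]
      · exact hfix
    · rintro rfl
      exact ⟨v.isPrime, inferInstance⟩
  rw [hsub, Set.ncard_singleton] at hq2
  omega

/-- **Valuation bound for the Kummer exponent**: if `(β) = v^A (t)` with `t ∈ ℤ ∖ {0}`, `τ v ≠ v`, and
`β γ₂^{3^j} = (τβ) γ₁^{3^j}` in `𝓞_K` (i.e. `β/τβ = (γ₁/γ₂)^{3^j}`), then `3^j ∣ A`: count the prime
`v` in both sides (`FractionalIdeal.count`; `count_v (τβ) = count_v (t)` as `τ v ≠ v`). [folklore] -/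
theorem pow_dvd_of_smul_rel {τ : K ≃ₐ[ℚ] K} {v : HeightOneSpectrum (𝓞 K)} (hτv : τ • v.asIdeal ≠ v.asIdeal)
    {A : ℕ} {t : ℤ} (ht : t ≠ 0) {β : 𝓞 K} (hβ : v.asIdeal ^ A * Ideal.span {(t : 𝓞 K)} = Ideal.span {β})
    {j : ℕ} {γ₁ γ₂ : 𝓞 K} (hγ₂ : γ₂ ≠ 0) (hrel : β * γ₂ ^ 3 ^ j = (τ • β) * γ₁ ^ 3 ^ j) :
    3 ^ j ∣ A := by
  classical
  have ht' : (t : 𝓞 K) ≠ 0 := by exact_mod_cast ht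
  have hI0 : v.asIdeal ^ A * Ideal.span {(t : 𝓞 K)} ≠ ⊥ :=
    mul_ne_zero (pow_ne_zero A v.ne_bot) (by rw [Ne, Ideal.zero_eq_bot, Ideal.span_singleton_eq_bot]; exact ht')
  have hβ0 : β ≠ 0 := by
    intro h0; apply hI0; rw [hβ, h0, Ideal.span_singleton_eq_bot]
  have hτβ0 : τ • β ≠ 0 := (smul_ne_zero_iff_ne τ).mpr hβ0
  have hγ₁0 : γ₁ ≠ 0 := by
    intro h0
    rw [h0, zero_pow (pow_ne_zero j (by norm_num)), mul_zero] at hrel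
    exact (mul_ne_zero hβ0 (pow_ne_zero _ hγ₂)) hrel
  have hsmul_span : ∀ x : 𝓞 K, τ • Ideal.span {x} = Ideal.span {τ • x} := fun x => by
    rw [Ideal.pointwise_smul_def, Ideal.map_span, Set.image_singleton]; rfl
  have hτt : τ • (t : 𝓞 K) = t := map_intCast (MulSemiringAction.toRingHom (K ≃ₐ[ℚ] K) (𝓞 K) τ) t
  -- the conjugate prime `w = τ • v`
  let w : HeightOneSpectrum (𝓞 K) :=
    ⟨τ • v.asIdeal, inferInstance, fun h => v.ne_bot (by
      have := congrArg (fun I : Ideal (𝓞 K) => τ⁻¹ • I) h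
      simpa only [inv_smul_smul, Ideal.smul_bot] using this)⟩
  have hw : w ≠ v := fun h => hτv (congrArg HeightOneSpectrum.asIdeal h)
  have hβ' : w.asIdeal ^ A * Ideal.span {(t : 𝓞 K)} = Ideal.span {τ • β} := by
    have h := congrArg (fun I : Ideal (𝓞 K) => τ • I) hβ
    simp only [smul_mul', smul_pow', hsmul_span, hτt] at h
    exact h
  -- pass to fractional ideals and count at `v`
  have hcnt := fun (I : Ideal (𝓞 K)) => FractionalIdeal.count K v (I : FractionalIdeal (𝓞 K)⁰ K)
  have hne : ∀ {I : Ideal (𝓞 K)}, I ≠ ⊥ → (I : FractionalIdeal (𝓞 K)⁰ K) ≠ 0 :=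
    fun h => FractionalIdeal.coeIdeal_ne_zero.mpr h
  have hsp : ∀ {x : 𝓞 K}, x ≠ 0 → (Ideal.span {x} : Ideal (𝓞 K)) ≠ ⊥ :=
    fun h => by rwa [Ne, Ideal.span_singleton_eq_bot]
  -- `count_v (β) = A + count_v (t)` and `count_v (τβ) = count_v (t)`
  have h1 : FractionalIdeal.count K v ((Ideal.span {β} : Ideal (𝓞 K)) : FractionalIdeal (𝓞 K)⁰ K) =
      A + FractionalIdeal.count K v ((Ideal.span {(t : 𝓞 K)} : Ideal (𝓞 K)) : FractionalIdeal (𝓞 K)⁰ K) := by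
    rw [← hβ, FractionalIdeal.coeIdeal_mul, FractionalIdeal.count_mul K v (hne (pow_ne_zero A v.ne_bot)) (hne (hsp ht')),
      FractionalIdeal.coeIdeal_pow, FractionalIdeal.count_pow, FractionalIdeal.count_self, mul_one]
  have h2 : FractionalIdeal.count K v ((Ideal.span {τ • β} : Ideal (𝓞 K)) : FractionalIdeal (𝓞 K)⁰ K) =
      FractionalIdeal.count K v ((Ideal.span {(t : 𝓞 K)} : Ideal (𝓞 K)) : FractionalIdeal (𝓞 K)⁰ K) := by
    rw [← hβ', FractionalIdeal.coeIdeal_mul, FractionalIdeal.count_mul K v (hne (pow_ne_zero A w.ne_bot)) (hne (hsp ht')),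
      FractionalIdeal.coeIdeal_pow, FractionalIdeal.count_pow, FractionalIdeal.count_maximal_coprime K v hw,
      mul_zero, zero_add]
  -- the relation `(β)(γ₂)^{3^j} = (τβ)(γ₁)^{3^j}`
  have h3 : (Ideal.span {β} : Ideal (𝓞 K)) * Ideal.span {γ₂} ^ 3 ^ j =
      Ideal.span {τ • β} * Ideal.span {γ₁} ^ 3 ^ j := by
    rw [Ideal.span_singleton_pow, Ideal.span_singleton_pow, Ideal.span_singleton_mul_span_singleton,
      Ideal.span_singleton_mul_span_singleton, hrel]
  have h4 := congrArg (fun I : Ideal (𝓞 K) => FractionalIdeal.count K v (I : FractionalIdeal (𝓞 K)⁰ K)) h3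
  simp only [FractionalIdeal.coeIdeal_mul, FractionalIdeal.coeIdeal_pow] at h4
  rw [FractionalIdeal.count_mul K v (hne (hsp hβ0)) (pow_ne_zero _ (hne (hsp hγ₂))),
    FractionalIdeal.count_mul K v (hne (hsp hτβ0)) (pow_ne_zero _ (hne (hsp hγ₁0))),
    FractionalIdeal.count_pow, FractionalIdeal.count_pow, h1, h2] at h4
  -- `A + c_t + 3^j c₂ = c_t + 3^j c₁` in `ℤ`
  have h5 : (A : ℤ) = 3 ^ j * (FractionalIdeal.count K v ((Ideal.span {γ₁} : Ideal (𝓞 K)) : FractionalIdeal (𝓞 K)⁰ K) -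
      FractionalIdeal.count K v ((Ideal.span {γ₂} : Ideal (𝓞 K)) : FractionalIdeal (𝓞 K)⁰ K)) := by
    push_cast at h4 ⊢
    linarith
  have h6 : ((3 ^ j : ℕ) : ℤ) ∣ (A : ℤ) :=
    ⟨FractionalIdeal.count K v ((Ideal.span {γ₁} : Ideal (𝓞 K)) : FractionalIdeal (𝓞 K)⁰ K) -
      FractionalIdeal.count K v ((Ideal.span {γ₂} : Ideal (𝓞 K)) : FractionalIdeal (𝓞 K)⁰ K), by rw [h5]; push_cast; ring⟩
  exact Int.natCast_dvd_natCast.mp h6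

/-- In a number field whose unit group has two elements, a root of unity of odd order is `1`
(it is a unit, hence `±1`, and `(-1)^{odd} ≠ 1`). [folklore] -/
theorem eq_one_of_pow_eq_one_of_odd (hunits : Nat.card (𝓞 K)ˣ = 2) {u : K} {n : ℕ} (hn : Odd n)
    (hu : u ^ n = 1) : u = 1 := by
  have hn0 : 0 < n := hn.pos
  have hint : IsIntegral ℤ u := IsIntegral.of_pow hn0 (by rw [hu]; exact isIntegral_one)
  set u' : 𝓞 K := ⟨u, hint⟩ with hu'
  have hu'n : u' ^ n = 1 := by
    rw [RingOfIntegers.ext_iff, RingOfIntegers.coe_eq_algebraMap, RingOfIntegers.coe_eq_algebraMap,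
      map_pow, map_one, show algebraMap (𝓞 K) K u' = u from rfl, hu]
  have hunit : IsUnit u' := IsUnit.of_pow_eq_one hu'n hn0.ne'
  obtain ⟨w, hw⟩ := hunit
  rcases Literature.NumberTheory.ComplexMultiplication.CMTypeLattice.units_eq_one_or_neg_one_of_natCard_eq_two
    hunits w with h1 | h1
  · have : u' = 1 := by rw [← hw, h1, Units.val_one]
    simpa [hu'] using congrArg (fun z : 𝓞 K => (z : K)) this
  · exfalso
    have h2 : u' = -1 := by rw [← hw, h1, Units.val_neg, Units.val_one]
    rw [h2, hn.neg_one_pow] at hu'n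
    have h3 : ((-1 : 𝓞 K) : K) = ((1 : 𝓞 K) : K) := congrArg (fun z : 𝓞 K => (z : K)) hu'n
    norm_num at h3

end Summit.BirchSwinnertonDyer.BirchSwinnertonDyer.Theorems.ChebSupply

end
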